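import Literature.AnabelianGeometry.SemiGraphs.WitnessIwahoriSeqGroup
import Literature.AnabelianGeometry.SemiGraphs.IncoherentBouquet
import HarnessLib

/-!
# The estranged loop `𝒢_ω` with vertex group `P_ω = ℤ_p^ℕ ⋊ (1 + pℤ_p)`: ALL the hypotheses of
# [SemiAnbd] Thm. 3.7 hold, yet `𝒢_ω` is NOT coherent

abc-iut cell, layer L3, route T · T7d∞-NEG37 (seat abc-iut-L3-t5; L3-lead β30).  FRONTIER label:
erratum-grade TIGHTNESS material for the cell's own heredity theorems (route T: `CoveringGraphCoherent`,
`CoveringGraphFiniteDegree`, `CoveringGraphGaloisCountableNegative`); it retypes and changes NO statement of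
record and lies outside the [IUTchIII] Cor. 3.12 cone.  Source of the hypothesis bundles: S. Mochizuki,
*Semi-graphs of anabelioids*, Publ. RIMS **42** (2006), Def. 2.1 p. 22 (injective type), Def. 2.3 pp. 24–25
(approximators, quasi-coherent, COHERENT = quasi-coherent with topologically finitely generated
constituents), Def. 2.4 (i)/(ii)/(iv) pp. 25–26 (elevated / verticially slim / aloof, estranged), Prop. 3.6
p. 38, Thm. 3.7 p. 40, with the Galois-countability erratum [IUTchI] Rmk. 2.5.3 (i) (T2) as bundled in the
tree's `Prop36Hypotheses` / `Thm37Hypotheses`.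

THE OBJECT `seqLoop p`: gen 6's loop `IncoherentBouquet.loop` (one vertex, one edge, branches `false`,
`true`) with vertex group `P_ω = IwSeq p` (`WitnessIwahoriSeqGroup`), edge group `U = 1 + pℤ_p`
(`IwU p`, w5's `WitnessIwahoriGroup`), the branch `false` mapping `U` onto the diagonal torus
`T_0 = bHomSeq 0`, the branch `true` onto the complement `T_{δ_0} = bHomSeq (δ_0)` twisted at the
coordinate `0` only — coordinatewise w5's estranged loop `𝒢₁` (`WitnessIwahoriLoop/Approx/Bundle`, cited
and consumed by name).

KERNEL-CHECKED: every clause of `Thm37Hypotheses` (`seqLoop_thm37Hypotheses`: connected, countable,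
Galois-countable via the level approximators `approx n` — finite quotients
`P_ω → (image in) ∏_{i ≤ n} P_{n+1}` — and their trivialising coverings, a vertex, injective type,
quasi-coherent, totally elevated, totally aloof AND estranged, verticially slim) and
**`seqLoop_not_isCoherent`** (`P_ω` is not topologically finitely generated, `IwSeq.not_topologicallyFG`),
packaged as `exists_thm37Hypotheses_not_isCoherent`.  The companion `CoveringGraphGaloisCountableNegativeThm37`
unwinds this loop.  No side is taken on [IUTchIII] Cor. 3.12. [cite: MochizukiSemiAnbd2006, Thm 3.7 p.40]
-/

noncomputable section

open CategoryTheory Topology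

namespace Literature.AnabelianGeometry.SemiGraphs

open IwahoriWitness
open Literature.AlgebraicGeometry.Frobenioids (IsSlimGroup)
open Literature.AlgebraicGeometry.Frobenioids.QuasiTemperoid.BTempConnected (ρ_one_apply)

variable (p : ℕ) [Fact p.Prime]

namespace IwSeq

variable {p}

/-! ## 1. Finite levels of `P_ω` -/

/-- The level-`n` reduction of `P_ω`: the coordinates `i < n` read in `P_n = (ℤ/pⁿ) ⋊ U_n`.
[cite: MochizukiSemiAnbd2006, Def 2.3(i) p.24] -/
def toMod (n : ℕ) : IwSeq p →* (Fin n → IwMod p n) :=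
  (MonoidHom.pi fun i : Fin n => (Iw.toMod n).comp (Pi.evalMonoidHom (fun _ : ℕ => Iw p) i.1)).comp
    (seqSubgroup p).subtype

/-- The level-`n` reduction, coordinatewise. [cite: MochizukiSemiAnbd2006, Def 2.3(i) p.24] -/
@[simp] theorem toMod_apply (n : ℕ) (x : IwSeq p) (i : Fin n) : toMod n x i = Iw.toMod n (x.1 i.1) := rfl

/-- The kernel of the level-`n` reduction. [cite: MochizukiSemiAnbd2006, Def 2.3(i) p.24] -/
theorem toMod_eq_one_iff (n : ℕ) (x : IwSeq p) : toMod n x = 1 ↔ ∀ i : Fin n, Iw.toMod n (x.1 i.1) = 1 :=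
  ⟨fun h i => by rw [← toMod_apply, h]; rfl, fun h => funext fun i => h i⟩

/-- The kernel of the level-`n` reduction is open. [cite: MochizukiSemiAnbd2006, Def 2.3(i) p.24] -/
theorem isOpen_ker_toMod (n : ℕ) : IsOpen ((toMod (p := p) n).ker : Set (IwSeq p)) := by
  have : ((toMod (p := p) n).ker : Set (IwSeq p)) =
      ⋂ i : Fin n, (fun x : IwSeq p => x.1 i.1) ⁻¹' ((Iw.toMod (p := p) n).ker : Set (Iw p)) := by
    ext x
    simp only [SetLike.mem_coe, MonoidHom.mem_ker, toMod_eq_one_iff, Set.mem_iInter, Set.mem_preimage]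
  rw [this]
  exact isOpen_iInter_of_finite fun i =>
    (Iw.isOpen_ker_toMod n).preimage ((continuous_apply i.1).comp continuous_subtype_val)

/-- The kernel of the action of `P_ω` on a FINITE object of `B^temp(P_ω)` contains the kernel of the
level-`(n+1)` reduction for `n` large (stabilisers are open; open sets contain level boxes).
[cite: MochizukiSemiAnbd2006, Def 2.3(iii) p.25] -/
theorem exists_level_acts_trivially (X : BTemp (IwSeq p)) [Finite X.obj.V] :
    ∃ n₀ : ℕ, ∀ n, n₀ ≤ n → ∀ g : IwSeq p, toMod (n + 1) g = 1 → ∀ x : X.obj.V, X.obj.ρ g x = x := by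
  have hopen : IsOpen {g : IwSeq p | ∀ x : X.obj.V, X.obj.ρ g x = x} := by
    have : {g : IwSeq p | ∀ x : X.obj.V, X.obj.ρ g x = x} = ⋂ x : X.obj.V, {g | X.obj.ρ g x = x} := by
      ext g; simp
    rw [this]
    exact isOpen_iInter_of_finite fun x => X.property.2 x
  obtain ⟨I, N, hbox⟩ :=
    exists_finset_level_of_mem_nhds (hopen.mem_nhds (by intro x; exact ρ_one_apply X x))
  refine ⟨max N (I.sup id), fun n hn g hg x => ?_⟩
  have hg' : ∀ x : X.obj.V, X.obj.ρ g x = x := hbox g fun i hi => by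
    have hi' : i < n + 1 :=
      Nat.lt_succ_of_le ((Finset.le_sup (f := id) hi).trans ((le_max_right _ _).trans hn))
    exact Iw.toMod_eq_one_mono ((le_max_left _ _).trans (hn.trans (Nat.le_succ n))) _
      ((toMod_eq_one_iff (n + 1) g).1 hg ⟨i, hi'⟩)
  exact hg' x

end IwSeq

namespace IwSeqWitness

/-! ## 2. The object `𝒢_ω` and its combinatorial clauses -/

/-- The coefficient vector of a branch: `false ↦ 0` (diagonal torus), `true ↦ δ_0` (twist at the
coordinate `0` only). [cite: MochizukiSemiAnbd2006, Def 2.1 p.22] -/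
def cvec (b : Bool) : ℕ → ℤ_[p] := Pi.single 0 (if b then 1 else 0)

/-- The coefficient vector at the coordinate `0`. [cite: MochizukiSemiAnbd2006, Def 2.1 p.22] -/
theorem cvec_zero (b : Bool) : cvec p b 0 = if b then 1 else 0 := Pi.single_eq_same _ _

/-- The coefficient vectors vanish off the coordinate `0`. [cite: MochizukiSemiAnbd2006, Def 2.1 p.22] -/
theorem cvec_of_ne_zero (b : Bool) {i : ℕ} (h : i ≠ 0) : cvec p b i = 0 := Pi.single_eq_of_ne h _

/-- Distinct branches carry the coefficient pair `{0, 1}` at the coordinate `0`. [cite: MochizukiSemiAnbd2006, §1 p.11] -/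
theorem cvec_pair_of_ne {b b' : Bool} (h : b' ≠ b) :
    (cvec p b 0 = 0 ∧ cvec p b' 0 = 1) ∨ (cvec p b 0 = 1 ∧ cvec p b' 0 = 0) := by
  rw [cvec_zero, cvec_zero]
  cases b <;> cases b' <;> simp_all

/-- **The witness `𝒢_ω`**: the loop with vertex group `P_ω = ℤ_p^ℕ ⋊ (1 + pℤ_p)`, edge group
`U = 1 + pℤ_p`, branch maps the diagonal torus / the complement twisted at the coordinate `0`.
A DEFINITION (countermodel base); nothing of the paper is asserted. [cite: MochizukiSemiAnbd2006, Def 2.1 p.22] -/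
@[reducible] def seqLoop : ProfiniteSemiGraph.{0} where
  graph := ProfiniteSemiGraph.IncoherentBouquet.loop
  Gv _ := IwSeq p
  Ge _ := IwU p
  compactSpaceV _ := IwSeq.compactSpace
  brHom b _ _ := IwSeq.bHomSeq (cvec p b)

/-- The branch subgroups of `𝒢_ω` are the `T_{cvec b}`. [cite: MochizukiSemiAnbd2006, §2 p.23] -/
theorem seqLoop_branchSubgroup (b : Bool) (v : Unit) (h : ProfiniteSemiGraph.IncoherentBouquet.loop.abuts b = some v) :
    (seqLoop p).branchSubgroup b v h = (IwSeq.bHomSeq (cvec p b)).toMonoidHom.range := rfl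

/-- `𝒢_ω` is connected. [cite: MochizukiSemiAnbd2006, §1 p.11] -/
theorem seqLoop_isConnected : (seqLoop p).IsConnected := ProfiniteSemiGraph.IncoherentBouquet.bouquet_isConnected

/-- `𝒢_ω` is countable. [cite: MochizukiSemiAnbd2006, §1 p.11] -/
theorem seqLoop_isCountable : (seqLoop p).IsCountable := ⟨inferInstance, inferInstance⟩

/-- `𝒢_ω` has a vertex. [cite: MochizukiSemiAnbd2006, Thm 3.7 p.40] -/
theorem seqLoop_hasVertex : (seqLoop p).HasVertex := ⟨()⟩

/-- `𝒢_ω` is a graph (every branch abuts). [cite: MochizukiSemiAnbd2006, §1 p.11] -/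
theorem seqLoop_isGraph : (seqLoop p).IsGraph := ⟨fun _ => rfl⟩

/-- `𝒢_ω` is of injective type. [cite: MochizukiSemiAnbd2006, Def 2.1 p.22] -/
theorem seqLoop_isOfInjectiveType : (seqLoop p).IsOfInjectiveType := fun b _ _ => IwSeq.bHomSeq_injective (cvec p b)

/-- `𝒢_ω` is verticially slim (`P_ω` is slim). [cite: MochizukiSemiAnbd2006, Def 2.4(ii) p.25] -/
theorem seqLoop_isVerticiallySlim : (seqLoop p).IsVerticiallySlim := fun _ => IwSeq.isSlimGroup

/-- The core intersection computation: for branches `b, b'` and `g ∈ P_ω` with `b' ≠ b` or `g ∉ Π_b`,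
`Π_b ∩ g Π_{b'} g⁻¹ = 1`. [cite: MochizukiSemiAnbd2006, Def 2.4(iv) p.26] -/
theorem seqLoop_branch_inf_conj_eq_bot (b b' : Bool) (g : IwSeq p)
    (hg : b' ≠ b ∨ g ∉ (IwSeq.bHomSeq (cvec p b)).toMonoidHom.range) :
    (IwSeq.bHomSeq (cvec p b)).toMonoidHom.range ⊓
      ((IwSeq.bHomSeq (cvec p b')).toMonoidHom.range.map (MulAut.conj g).toMonoidHom) = ⊥ := by
  by_cases hbb : b' = b
  · subst hbb
    exact IwSeq.range_bHomSeq_inf_conj_eq_bot_of_not_mem _ (hg.resolve_left fun h => h rfl)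
  · exact IwSeq.range_bHomSeq_inf_conj_eq_bot_of_ne (cvec_pair_of_ne p hbb) g

/-- Every edge of `𝒢_ω` is aloof. [cite: MochizukiSemiAnbd2006, Def 2.4(iv) p.26] -/
theorem seqLoop_isTotallyAloof : (seqLoop p).IsTotallyAloof := by
  intro e b _ v h b' h' g hg
  rw [seqLoop_branchSubgroup] at hg ⊢
  rw [seqLoop_branchSubgroup]
  exact IwSeq.relIndex_eq_zero_of_inf_eq_bot _ (seqLoop_branch_inf_conj_eq_bot p b b' g hg)

/-- **Every edge of `𝒢_ω` is estranged.** [cite: MochizukiSemiAnbd2006, Def 2.4(iv) p.26] -/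
theorem seqLoop_isTotallyEstranged : (seqLoop p).IsTotallyEstranged := by
  intro e
  refine ⟨seqLoop_isTotallyAloof p e, ?_⟩
  intro b _ v h b' h' g hg
  rw [seqLoop_branchSubgroup] at hg ⊢
  rw [seqLoop_branchSubgroup]
  exact seqLoop_branch_inf_conj_eq_bot p b b' g hg

/-! ## 3. The level approximators of `𝒢_ω` -/

/-- The coefficient vector of a branch read modulo `pⁿ` on the coordinates `< n`.
[cite: MochizukiSemiAnbd2006, Def 2.3(i) p.24] -/
def cvecMod (n : ℕ) (b : Bool) (i : Fin n) : ZMod (p ^ n) := PadicInt.toZModPow n (cvec p b i.1)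

/-- The branch map at level `n`: `U_n → (image of P_ω in ∏_{i<n} P_n)`, coordinatewise w5's `brMod`;
it lands in the image because it is the reduction of `b_{cvec b}`. [cite: MochizukiSemiAnbd2006, Def 2.3(i) p.24] -/
def brFMod (n : ℕ) (b : Bool) : IwUMod p n →* ↥(IwSeq.toMod (p := p) n).range :=
  (MonoidHom.pi fun i : Fin n => IwMod.brMod (cvecMod p n b i)).codRestrict _ fun u => by
    obtain ⟨u, rfl⟩ := IwU.toMod_surjective n u
    refine ⟨IwSeq.bHomSeq (cvec p b) u, funext fun i => IwMod.ext ?_ rfl⟩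
    show PadicInt.toZModPow n (cvec p b i.1 * u.s) = PadicInt.toZModPow n (cvec p b i.1) * PadicInt.toZModPow n u.s
    rw [map_mul]

/-- The level-`n` branch map, coordinatewise. [cite: MochizukiSemiAnbd2006, Def 2.3(i) p.24] -/
theorem brFMod_apply (n : ℕ) (b : Bool) (u : IwUMod p n) (i : Fin n) :
    (brFMod p n b u).1 i = IwMod.brMod (cvecMod p n b i) u := rfl

/-- The level-`(n+1)` branch maps are injective (read the unit coordinate at `0`).
[cite: MochizukiSemiAnbd2006, Def 2.3(i) p.24] -/
theorem brFMod_injective (n : ℕ) (b : Bool) : Function.Injective (brFMod p (n + 1) b) := fun u v h => by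
  have := congrArg (fun z : ↥(IwSeq.toMod (p := p) (n + 1)).range => (z.1 ⟨0, Nat.succ_pos n⟩).s) h
  exact IwUMod.ext this

/-- **The level-`(n+1)` approximator of `𝒢_ω`** (Def. 2.3 (i)(ii)): the finite image of `P_ω` in
`∏_{i ≤ n} P_{n+1}`, `U_{n+1}`, the reductions, the branch maps reduced on the nose (`g = 1`), of bounded
order. [cite: MochizukiSemiAnbd2006, Def 2.3(i) p.24] -/
def approx (n : ℕ) : (seqLoop p).Approximator where
  FV _ := ↥(IwSeq.toMod (p := p) (n + 1)).range
  FE _ := IwUMod p (n + 1)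
  πV _ := (IwSeq.toMod (n + 1)).rangeRestrict
  πE _ := IwU.toMod (n + 1)
  isOpen_ker_πV _ := by
    rw [MonoidHom.ker_rangeRestrict]
    exact IwSeq.isOpen_ker_toMod (n + 1)
  isOpen_ker_πE _ := IwU.isOpen_ker_toMod (n + 1)
  brF b _ _ := brFMod p (n + 1) b
  brF_injective b _ _ := brFMod_injective p n b
  comm b v h := ⟨1, fun x => by
    rw [one_mul, inv_one, mul_one]
    refine Subtype.ext (funext fun i => IwMod.ext ?_ rfl)
    show cvecMod p (n + 1) b i * PadicInt.toZModPow (n + 1) x.s =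
      PadicInt.toZModPow (n + 1) (cvec p b i.1 * x.s)
    rw [map_mul]; rfl⟩
  bounded := ⟨Nat.card ↥(IwSeq.toMod (p := p) (n + 1)).range, Nat.card_pos, fun _ => dvd_rfl⟩

/-- The approximators are `π₁`-epimorphic. [cite: MochizukiSemiAnbd2006, Def 2.3(ii) p.25] -/
theorem approx_isPiOneEpimorphic (n : ℕ) : (approx p n).IsPiOneEpimorphic :=
  ⟨fun _ => MonoidHom.rangeRestrict_surjective _, fun _ => IwU.toMod_surjective (n + 1)⟩

/-! ## 4. Quasi-coherence, total elevation, Galois-countability -/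

/-- **`𝒢_ω` is quasi-coherent**: a level approximator past the levels of the two finite constituent
coverings splits both. [cite: MochizukiSemiAnbd2006, Def 2.3(iii) p.25] -/
theorem seqLoop_isQuasiCoherent : (seqLoop p).IsQuasiCoherent := by
  intro M HV HE hV hE
  haveI : Finite (HV ()).obj.V := (hV ()).2
  haveI : Finite (HE ()).obj.V := (hE ()).2
  obtain ⟨n₁, hn₁⟩ := IwSeq.exists_level_acts_trivially (HV ())
  obtain ⟨n₂, hn₂⟩ := exists_level_acts_trivially_E p (HE ())
  refine ⟨approx p (max n₁ n₂), ?_, ?_⟩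
  · rintro ⟨⟩ g hg x
    have hg' : IwSeq.toMod (max n₁ n₂ + 1) g = 1 := by
      have := congrArg Subtype.val hg
      exact this
    exact hn₁ _ (le_max_left _ _) g hg' x
  · rintro ⟨⟩ g hg x
    exact hn₂ g (IwU.toMod_eq_one_mono (by omega) g hg) x

/-- The translation subgroup of the level: all unit coordinates `0`. [cite: MochizukiSemiAnbd2006, Def 2.4(i) p.25] -/
def translN (n : ℕ) : Subgroup ↥(IwSeq.toMod (p := p) (n + 1)).range where
  carrier := {z | ∀ i, (z.1 i).s = 0}
  mul_mem' {z z'} hz hz' i := by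
    show (z.1 i * z'.1 i).s = 0
    rw [IwMod.mul_s, hz i, hz' i]; ring
  one_mem' _ := rfl
  inv_mem' {z} hz i := by
    show ((z.1 i)⁻¹).s = 0
    rw [IwMod.inv_s, hz i]; ring

/-- The translations `(a·δ, 0)`, `a ∈ ℤ/p^{n+1}`, lie in the level image with unit coordinates `0`:
the translation subgroup has at least `p^{n+1} > n` elements. [cite: MochizukiSemiAnbd2006, Def 2.4(i) p.25] -/
theorem le_card_translN (n : ℕ) : n ≤ Nat.card (translN p n) := by
  haveI : NeZero (p ^ (n + 1)) := ⟨pow_ne_zero _ (Fact.out : p.Prime).ne_zero⟩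
  let f : ZMod (p ^ (n + 1)) → translN p n := fun a =>
    ⟨⟨IwSeq.toMod (n + 1) (IwSeq.mk (fun _ => (a.val : ℤ_[p])) 0), _, rfl⟩, fun i => by
      show PadicInt.toZModPow (n + 1) (0 : ℤ_[p]) = 0
      rw [map_zero]⟩
  have hf : Function.Injective f := fun a a' h => by
    have h' := congrArg (fun z : translN p n => (z.1.1 ⟨0, Nat.succ_pos n⟩).a) h
    change PadicInt.toZModPow (n + 1) ((a.val : ℤ_[p])) = PadicInt.toZModPow (n + 1) ((a'.val : ℤ_[p])) at h'
    rwa [map_natCast, map_natCast, ZMod.natCast_zmod_val, ZMod.natCast_zmod_val] at h'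
  calc n ≤ p ^ (n + 1) := ((Nat.lt_pow_self (Fact.out : p.Prime).one_lt).trans
        (Nat.pow_lt_pow_right (Fact.out : p.Prime).one_lt (Nat.lt_succ_self n))).le
    _ = Nat.card (ZMod (p ^ (n + 1))) := (Nat.card_zmod _).symm
    _ ≤ Nat.card (translN p n) := Nat.card_le_card_of_injective f hf

/-- The translation subgroup meets every conjugate of either level branch image trivially (read at
the coordinate `0`: a conjugate of a graph is a graph, whose only element with `s = 0` is `1`).
[cite: MochizukiSemiAnbd2006, Def 2.4(i) p.25] -/
theorem translN_inf_conj_range_brFMod (n : ℕ) (b : Bool) (g : ↥(IwSeq.toMod (p := p) (n + 1)).range) :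
    translN p n ⊓ ((brFMod p (n + 1) b).range.map (MulAut.conj g).toMonoidHom) = ⊥ := by
  rw [eq_bot_iff]
  rintro z ⟨hz, ⟨y, ⟨u, rfl⟩, rfl⟩⟩
  rw [Subgroup.mem_bot]
  have h0 : ((MulAut.conj g).toMonoidHom (brFMod p (n + 1) b u)).1 ⟨0, Nat.succ_pos n⟩ ∈
      IwMod.transl ⊓ ((IwMod.brMod (cvecMod p (n + 1) b ⟨0, Nat.succ_pos n⟩)).range.map
        (MulAut.conj (g.1 ⟨0, Nat.succ_pos n⟩)).toMonoidHom) :=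
    ⟨hz _, ⟨IwMod.brMod _ u, ⟨u, rfl⟩, rfl⟩⟩
  rw [IwMod.transl_inf_conj_range_brMod, Subgroup.mem_bot] at h0
  -- `g₀ (brMod u) g₀⁻¹ = 1` forces `u = 1`
  have hy : IwMod.brMod (cvecMod p (n + 1) b ⟨0, Nat.succ_pos n⟩) u = 1 := by
    have h1 : g.1 ⟨0, Nat.succ_pos n⟩ * IwMod.brMod (cvecMod p (n + 1) b ⟨0, Nat.succ_pos n⟩) u *
        (g.1 ⟨0, Nat.succ_pos n⟩)⁻¹ = 1 := h0
    rwa [mul_inv_eq_one, mul_eq_left] at h1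
  have hu : u = 1 := IwMod.brMod_injective _ (by rw [hy, map_one])
  rw [hu, map_one, map_one]

/-- **`𝒢_ω` is totally elevated.** [cite: MochizukiSemiAnbd2006, Def 2.4(i) p.25] -/
theorem seqLoop_isTotallyElevated : (seqLoop p).IsTotallyElevated := by
  intro v M
  refine ⟨approx p M, approx_isPiOneEpimorphic p M, translN p M, le_card_translN p M, ?_⟩
  intro b h g
  exact translN_inf_conj_range_brFMod p M b g

/-- The trivialising covering of the level-`(n+1)` approximator. [cite: MochizukiSemiAnbd2006, Prop 2.5 p.27] -/
def levelCov (n : ℕ) : ProfiniteSemiGraph.CovObj (seqLoop p) :=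
  (approx p n).trivCov (M := Nat.card ↥(IwSeq.toMod (p := p) (n + 1)).range) Nat.card_pos fun _ => dvd_rfl

/-- **`𝒢_ω` is Galois-countable** ([IUTchI] Rmk. 2.5.3 (i) (T2)): the trivialising coverings of the
level approximators split every finite object (their point stabilisers are the level kernels).
[cite: Mochizuki2012, IUTchI Rmk 2.5.3 (i) (T2), p. 52] -/
theorem seqLoop_isGaloisCountable : (seqLoop p).IsGaloisCountable := by
  refine ⟨seqLoop_isCountable p, levelCov p, fun n => ⟨(approx p n).trivCov_isFinite _ _,
    (approx p n).trivCov_hasNonemptyFibres _ _⟩, fun H hH => ?_⟩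
  haveI : Finite (H.SV ()).obj.V := hH.finite_V ()
  haveI : Finite (H.SE ()).obj.V := hH.finite_E ()
  obtain ⟨n₁, h₁⟩ := IwSeq.exists_level_acts_trivially (H.SV ())
  obtain ⟨n₂, h₂⟩ := exists_level_acts_trivially_E p (H.SE ())
  refine ⟨max n₁ n₂, ?_, ?_⟩
  · rintro ⟨⟩ x g hgx s
    have h' : ((approx p (max n₁ n₂)).objV (Nat.card ↥(IwSeq.toMod (p := p) (max n₁ n₂ + 1)).range)
        ()).obj.ρ g x = x := hgx
    rw [ProfiniteSemiGraph.Approximator.objV_ρ] at h'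
    have hπ : (IwSeq.toMod (max n₁ n₂ + 1)).rangeRestrict g = 1 := mul_eq_right.1 (Prod.ext_iff.1 h').1
    exact h₁ _ (le_max_left _ _) g (congrArg Subtype.val hπ) s
  · rintro ⟨⟩ x g hgx s
    have h' : ((approx p (max n₁ n₂)).objE (Nat.card ↥(IwSeq.toMod (p := p) (max n₁ n₂ + 1)).range)
        ()).obj.ρ g x = x := hgx
    rw [ProfiniteSemiGraph.Approximator.objE_ρ] at h'
    have hπ : IwU.toMod (max n₁ n₂ + 1) g = 1 := mul_eq_right.1 (Prod.ext_iff.1 h').1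
    exact h₂ g (IwU.toMod_eq_one_mono (by omega) g hπ) s

/-! ## 5. The bundles; `𝒢_ω` is not coherent -/

/-- **`𝒢_ω` satisfies the hypotheses of Prop. 3.6.** [cite: MochizukiSemiAnbd2006, Prop 3.6 p.38] -/
theorem seqLoop_prop36Hypotheses : (seqLoop p).Prop36Hypotheses where
  isConnected := seqLoop_isConnected p
  isCountable := seqLoop_isCountable p
  isGaloisCountable := seqLoop_isGaloisCountable p
  hasVertex := seqLoop_hasVertex p
  isOfInjectiveType := seqLoop_isOfInjectiveType p
  isQuasiCoherent := seqLoop_isQuasiCoherent p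
  isTotallyElevated := seqLoop_isTotallyElevated p
  isTotallyAloof := seqLoop_isTotallyAloof p
  isVerticiallySlim := seqLoop_isVerticiallySlim p

/-- **`𝒢_ω` satisfies the hypotheses of Thm. 3.7** (totally estranged). [cite: MochizukiSemiAnbd2006, Thm 3.7 p.40] -/
theorem seqLoop_thm37Hypotheses : (seqLoop p).Thm37Hypotheses where
  toProp36Hypotheses := seqLoop_prop36Hypotheses p
  isTotallyEstranged := seqLoop_isTotallyEstranged p

/-- **`𝒢_ω` satisfies the hypotheses of Cor. 3.9** (a totally estranged GRAPH of anabelioids).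
[cite: MochizukiSemiAnbd2006, Cor 3.9 p.42] -/
theorem seqLoop_cor39Hypotheses : ProfiniteSemiGraph.Cor39Hypotheses (seqLoop p) where
  toProp36Hypotheses := seqLoop_prop36Hypotheses p
  isTotallyEstranged := seqLoop_isTotallyEstranged p
  isGraph := seqLoop_isGraph p

/-- **`𝒢_ω` is NOT coherent**: its vertex group `P_ω` is not topologically finitely generated.
[cite: MochizukiSemiAnbd2006, Def 2.3(iii) p.25] -/
theorem seqLoop_not_isCoherent : ¬ (seqLoop p).IsCoherent := by
  rintro ⟨-, hV, -⟩
  exact IwSeq.not_topologicallyFG (hV ())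

/-- **Record (FRONTIER, tightness datum)**: the hypotheses of Thm. 3.7 as bundled in the tree do NOT imply
coherence — some `𝒢` satisfies `Thm37Hypotheses` and is not coherent.
[cite: MochizukiSemiAnbd2006, Thm 3.7 p.40] -/
theorem exists_thm37Hypotheses_not_isCoherent :
    ∃ 𝒢 : ProfiniteSemiGraph.{0}, 𝒢.Thm37Hypotheses ∧ ProfiniteSemiGraph.Cor39Hypotheses 𝒢 ∧ ¬ 𝒢.IsCoherent :=
  haveI : Fact (Nat.Prime 2) := ⟨Nat.prime_two⟩
  ⟨seqLoop 2, seqLoop_thm37Hypotheses 2, seqLoop_cor39Hypotheses 2, seqLoop_not_isCoherent 2⟩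

end IwSeqWitness

end Literature.AnabelianGeometry.SemiGraphs

end
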